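import Literature.Computability.AlgebraicComplexity.ValiantBooleanBridgeBurgisserProofs
import Literature.Computability.AlgebraicComplexity.BurgisserThm45Proofs
import HarnessLib

/-!
# Discharge of (A3): `booleanPart_VP_cktSize_holds`

Topic `Literature/Computability/AlgebraicComplexity`; proof-only companion of
`BurgisserBooleanParts.lean`. The named fact **(A3)**
`Literature.Computability.AlgebraicComplexity.booleanPart_VP_cktSize k` (Bürgisser, *Cook's versus
Valiant's hypothesis*, TCS 235 (2000), Thm. 1.1(1), p. 73, second inclusion
`BP(VP_k) ⊆ FNC³/poly` in characteristic zero under GRH, weakened to polynomial-size `B₂`-circuits;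
proved in §5 (A3), pp. 85–86; book: *Completeness and Reduction in Algebraic Complexity Theory*,
Thm. 4.5) is now a THEOREM of the tree. Every step of the printed proof was already proved in the
tree down to the single named fact `algebraicSolution_height_bound` (TCS Thm. 4.5, p. 82: small
algebraic solutions of solvable integer systems):

* skeleton of the circuits (constants ↦ indeterminates), Nullstellensatz transfer `k ⇝ ℂ`, degree
  and weight bounds of the system `S_n` — `BurgisserBooleanPartsA3Steps.lean`;
* Thm. 4.1 (reduction modulo small primes under GRH) from Thm. 4.5, Rem. 4.6 and Cor. 4.8 —
  `BurgisserReductionModPrimes.lean`; Cor. 4.8 from the effective prime ideal theorem under GRH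
  (eq. (3) p. 83, Lagarias–Odlyzko) — `BurgisserRootCountGRH.lean`, the latter DISCHARGED
  (`Literature.NumberTheory.LFunctions.NumberField.effectivePrimeIdealTheorem_of_ERH_holds`);
* Chebyshev's bound, the choice of the prime `p_n ∈ (2^{t(n)}, 2^{μ(n)}]`, the Boolean simulation
  of the circuit over `𝔽_{p_n}` and the assembly — `BurgisserBooleanPartsModPCircuits.lean`,
  `BurgisserBooleanPartsA3Assembly.lean`, `ValiantBooleanBridgeBurgisserProofs.lean`
  (`booleanPart_VP_cktSize_of_heightBound`).

Thm. 4.5 itself is discharged in `BurgisserThm45Proofs.lean`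
(`algebraicSolution_height_bound_holds`), so the discharge of (A3) is the composition below.
This file contains no definitions.

## References

* P. Bürgisser, *Cook's versus Valiant's hypothesis*, Theoret. Comput. Sci. 235 (2000) 71–88,
  Thm. 1.1(1) p. 73, §5 (A3) pp. 85–86, Thm. 4.1 p. 80, Thm. 4.5 p. 82. [Burgisser2000TCS]
* P. Bürgisser, *Completeness and Reduction in Algebraic Complexity Theory*, Springer 2000,
  Thm. 4.5. [Burgisser2000]
-/

noncomputable section

namespace Literature.Computability.AlgebraicComplexity

universe u

variable (k : Type u) [Field k]

/-- **(A3) discharged** (Bürgisser 2000 TCS, Thm. 1.1(1), p. 73, second inclusion, proved in §5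
(A3), pp. 85–86; book Thm. 4.5): assuming the (Dedekind) generalised Riemann hypothesis, over a
field `k` of characteristic zero every Boolean part of a p-computable family is computed bitwise by
a polynomial-size family of `B₂`-circuits — the named fact `booleanPart_VP_cktSize k` holds. Proof:
the tree's reduction of (A3) to Thm. 4.5 (`booleanPart_VP_cktSize_of_heightBound`) applied to the
discharge of Thm. 4.5 (`algebraicSolution_height_bound_holds`).
[cite: Burgisser2000TCS, Thm. 1.1(1) p. 73 and §5 (A3) pp. 85–86] [cite: Burgisser2000, Thm. 4.5] -/
theorem booleanPart_VP_cktSize_holds : booleanPart_VP_cktSize k :=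
  booleanPart_VP_cktSize_of_heightBound k algebraicSolution_height_bound_holds

end Literature.Computability.AlgebraicComplexity

end
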